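import Summits.ValiantsHypothesis.ValiantsHypothesis.Theorems.LacunarySymmetroidMatrixDescartesCensusDoorA34SheetHyperbolicBlocks

/-!
# `MatrixDescartes` census — DOOR A at `(3,4)`: the MIDDLE WINDOW of the hyperbolic cell ALTERNATES AT MOST FIVE TIMES along positive points —
# the exact Descartes half of «every plane is crossed at most twice by the tiny-eigenvalue eigenvector curve» (`2·z ≤ 5`)

HONEST FRAMING.  Object-search cell `pub-symmetroid`, engine seat `val-sym-eng-2` (g7); helper row beside the registered strata line
`Cruxes/DoorA34/Lines/strata.lean` on stmt-ValiantsHypothesis-19980 (`DoorA34 = PosRootLawAt 3 4 18`: OPEN, typed, never asserted here), stub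
`stub_nullTopCeiling`, INDEFINITE cell.  …SheetHyperbolicBlocks proved that the middle block `v̂ᵀ adj(G) ŵ` of the core `G = Σ_{l<3} X^{d_l} S_l` lives on the
`≤ 6` pair sums; this file turns that into the ROOT-LEVEL alternation bound the seat's INDEFINITE WINDOW LAW uses in its regime (I) (report
HOME/DOOR-A34-ENG2G7-REPORT.md §2: there `aᵀadj(G)b ≈ μ·(a·u)(b·u)` along a case-I window, and `2·z_a ≤ 5` follows from the bound below applied to `b = a + εc`):

* `eval_middleBlock` — `(v̂ᵀ adj(G) ŵ)(x) = vᵀ adj(G(x)) w` (evaluation dictionary; any real vectors `v, w`, every support);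
* `signVariations_middleBlock_le_five` — the middle block has `≤ 5` coefficient sign variations (or is `0`);
* `sgnChanges_middleBlock_le_five` — **along any increasing list of positive points at which it is non-zero, `x ↦ vᵀ adj(G(x)) w` changes sign at most
  five times**;
* `no_seven_alternation_middleBlock` — hence it cannot be `> 0, < 0, > 0, < 0, > 0, < 0, > 0` at seven increasing positive points (nor the mirror pattern,
  `no_seven_alternation_middleBlock'`).

Nothing here bounds the count of `det F`; `DoorA34` and the three stubs stay OPEN; registers unchanged; nothing on `MatrixDescartes` (stmt-ValiantsHypothesis-18050)
or `VP ≠ VNP` — VP≠VNP not moved.  [folklore] Descartes' rule along points (tree `sgnChanges_eval_le_signVariations`), sparse support; elementary.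
-/

-- `Summit.ValiantsHypothesis.ValiantsHypothesis.…` repeats a component by the D-0017 layout
-- (single-conjunct summit), which the `dupNamespace` linter flags; the name is mandated.
set_option linter.dupNamespace false

namespace Summit.ValiantsHypothesis.ValiantsHypothesis.Theorems.LacunarySymmetroidMatrixDescartes.Census

open Polynomial Finset
open scoped BigOperators Polynomial Matrix
open Matrix
open Summit.ValiantsHypothesis.ValiantsHypothesis.Theorems.KPlusLogSqLaw.WindowDescartes (sgnChanges sgnChanges_eval_le_signVariations)

/-- **Evaluation dictionary for the middle block**: `(v̂ᵀ adj(G) ŵ)(x) = vᵀ adj(G(x)) w`. [folklore] -/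
theorem eval_middleBlock (d : Fin 4 → ℕ) (S : Fin 4 → Matrix (Fin 3) (Fin 3) ℝ) (v w : Fin 3 → ℝ) (x : ℝ) :
    ((fun i => C (v i)) ⬝ᵥ ((∑ l : Fin 3, ((X : ℝ[X]) ^ d (Fin.castSucc l)) • (S (Fin.castSucc l)).map C).adjugate *ᵥ fun i => C (w i))).eval x
      = v ⬝ᵥ ((∑ l : Fin 3, x ^ d (Fin.castSucc l) • S (Fin.castSucc l)).adjugate *ᵥ w) := by
  set M := (∑ l : Fin 3, ((X : ℝ[X]) ^ d (Fin.castSucc l)) • (S (Fin.castSucc l)).map C) with hM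
  have h2 : M.adjugate.map (eval x) = (M.map (eval x)).adjugate := by
    have := RingHom.map_adjugate (evalRingHom x) M
    simpa [RingHom.mapMatrix_apply, Polynomial.coe_evalRingHom] using this
  have hGx : M.map (eval x) = ∑ l : Fin 3, x ^ d (Fin.castSucc l) • S (Fin.castSucc l) := by
    rw [hM]; exact map_eval_pencil (fun l : Fin 3 => d (Fin.castSucc l)) (fun l => S (Fin.castSucc l)) x
  have hadj : ∀ i j, (M.adjugate i j).eval x = (∑ l : Fin 3, x ^ d (Fin.castSucc l) • S (Fin.castSucc l)).adjugate i j := by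
    intro i j
    have h := congrFun (congrFun h2 i) j
    rw [Matrix.map_apply, hGx] at h
    exact h
  simp only [dotProduct, Matrix.mulVec, Polynomial.eval_finsetSum, Polynomial.eval_mul, Polynomial.eval_C, hadj]

/-- The middle block has at most five coefficient sign variations. [folklore] -/
theorem signVariations_middleBlock_le_five (d : Fin 4 → ℕ) (S : Fin 4 → Matrix (Fin 3) (Fin 3) ℝ) (v w : Fin 3 → ℝ) :
    ((fun i => C (v i)) ⬝ᵥ ((∑ l : Fin 3, ((X : ℝ[X]) ^ d (Fin.castSucc l)) • (S (Fin.castSucc l)).map C).adjugate *ᵥ fun i => C (w i))).signVariations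
      ≤ 5 := by
  set g := ((fun i => C (v i)) ⬝ᵥ ((∑ l : Fin 3, ((X : ℝ[X]) ^ d (Fin.castSucc l)) • (S (Fin.castSucc l)).map C).adjugate *ᵥ fun i => C (w i)))
    with hg
  by_cases h0 : g = 0
  · rw [h0]; simp
  · have h1 := Literature.Computability.AlgebraicComplexity.signVariations_lt_card_support h0
    have h2 : g.support.card ≤ 6 := by
      rw [hg]
      exact (Finset.card_le_card (support_middleBlock_subset d S v w)).trans (card_pairSums_three_le (fun l : Fin 3 => d (Fin.castSucc l)))
    omega

/-- **The middle window alternates at most five times**: along an increasing list of positive points at which it does not vanish,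
`x ↦ vᵀ adj(G(x)) w` has at most five sign changes. [folklore] -/
theorem sgnChanges_middleBlock_le_five (d : Fin 4 → ℕ) (S : Fin 4 → Matrix (Fin 3) (Fin 3) ℝ) (v w : Fin 3 → ℝ)
    (xs : List ℝ) (hsort : xs.Pairwise (· < ·)) (hpos : ∀ x ∈ xs, 0 < x)
    (hne : ∀ x ∈ xs, v ⬝ᵥ ((∑ l : Fin 3, x ^ d (Fin.castSucc l) • S (Fin.castSucc l)).adjugate *ᵥ w) ≠ 0) :
    sgnChanges (xs.map fun x => v ⬝ᵥ ((∑ l : Fin 3, x ^ d (Fin.castSucc l) • S (Fin.castSucc l)).adjugate *ᵥ w)) ≤ 5 := by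
  set g := ((fun i => C (v i)) ⬝ᵥ ((∑ l : Fin 3, ((X : ℝ[X]) ^ d (Fin.castSucc l)) • (S (Fin.castSucc l)).map C).adjugate *ᵥ fun i => C (w i)))
    with hg
  have hmap : (xs.map fun x => v ⬝ᵥ ((∑ l : Fin 3, x ^ d (Fin.castSucc l) • S (Fin.castSucc l)).adjugate *ᵥ w)) = xs.map fun x => g.eval x := by
    refine List.map_congr_left fun x _ => ?_
    rw [hg, eval_middleBlock]
  rw [hmap]
  have hne' : ∀ y ∈ xs, g.eval y ≠ 0 := fun y hy => by rw [hg, eval_middleBlock]; exact hne y hy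
  exact (sgnChanges_eval_le_signVariations g xs hsort hpos hne').trans (signVariations_middleBlock_le_five d S v w)

/-- **NO SEVEN-POINT ALTERNATION OF THE MIDDLE WINDOW**: at seven increasing positive points the bilinear adjugate form of the core cannot be `> 0` at
the even and `< 0` at the odd positions. [folklore] -/
theorem no_seven_alternation_middleBlock (d : Fin 4 → ℕ) (S : Fin 4 → Matrix (Fin 3) (Fin 3) ℝ) (v w : Fin 3 → ℝ)
    (x : Fin 7 → ℝ) (hx : StrictMono x) (hx0 : 0 < x 0)
    (heven : ∀ i : Fin 7, (i : ℕ) % 2 = 0 → 0 < v ⬝ᵥ ((∑ l : Fin 3, x i ^ d (Fin.castSucc l) • S (Fin.castSucc l)).adjugate *ᵥ w))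
    (hodd : ∀ i : Fin 7, (i : ℕ) % 2 = 1 → v ⬝ᵥ ((∑ l : Fin 3, x i ^ d (Fin.castSucc l) • S (Fin.castSucc l)).adjugate *ᵥ w) < 0) : False := by
  set F : ℝ → ℝ := fun y => v ⬝ᵥ ((∑ l : Fin 3, y ^ d (Fin.castSucc l) • S (Fin.castSucc l)).adjugate *ᵥ w) with hF
  have hpos : ∀ y ∈ (List.ofFn x), 0 < y := by
    intro y hy
    rw [List.mem_ofFn] at hy
    obtain ⟨i, rfl⟩ := hy
    exact lt_of_lt_of_le hx0 (hx.monotone (Fin.zero_le i))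
  have hsort : (List.ofFn x).Pairwise (· < ·) := List.pairwise_ofFn.mpr fun i j hij => hx hij
  have hne : ∀ y ∈ (List.ofFn x), F y ≠ 0 := by
    intro y hy
    rw [List.mem_ofFn] at hy
    obtain ⟨i, rfl⟩ := hy
    rcases Nat.mod_two_eq_zero_or_one (i : ℕ) with h | h
    · exact (heven i h).ne'
    · exact (hodd i h).ne
  have hle := sgnChanges_middleBlock_le_five d S v w (List.ofFn x) hsort hpos hne
  have hlist : (List.ofFn x).map F = [F (x 0), F (x 1), F (x 2), F (x 3), F (x 4), F (x 5), F (x 6)] := by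
    simp [List.ofFn_succ, Fin.succ]
  have h6 := sgnChanges_seven_alternating (F (x 0)) (F (x 1)) (F (x 2)) (F (x 3)) (F (x 4)) (F (x 5)) (F (x 6))
    (heven 0 rfl) (hodd 1 rfl) (heven 2 rfl) (hodd 3 rfl) (heven 4 rfl) (hodd 5 rfl) (heven 6 rfl)
  rw [hlist, h6] at hle
  omega

/-- Mirror pattern: nor `< 0` at the even and `> 0` at the odd positions (apply the previous row to `−v`). [folklore] -/
theorem no_seven_alternation_middleBlock' (d : Fin 4 → ℕ) (S : Fin 4 → Matrix (Fin 3) (Fin 3) ℝ) (v w : Fin 3 → ℝ)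
    (x : Fin 7 → ℝ) (hx : StrictMono x) (hx0 : 0 < x 0)
    (heven : ∀ i : Fin 7, (i : ℕ) % 2 = 0 → v ⬝ᵥ ((∑ l : Fin 3, x i ^ d (Fin.castSucc l) • S (Fin.castSucc l)).adjugate *ᵥ w) < 0)
    (hodd : ∀ i : Fin 7, (i : ℕ) % 2 = 1 → 0 < v ⬝ᵥ ((∑ l : Fin 3, x i ^ d (Fin.castSucc l) • S (Fin.castSucc l)).adjugate *ᵥ w)) : False := by
  refine no_seven_alternation_middleBlock d S (-v) w x hx hx0 (fun i hi => ?_) (fun i hi => ?_)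
  · rw [neg_dotProduct]; exact neg_pos.mpr (heven i hi)
  · rw [neg_dotProduct]; exact neg_lt_zero.mpr (hodd i hi)

end Summit.ValiantsHypothesis.ValiantsHypothesis.Theorems.LacunarySymmetroidMatrixDescartes.Census
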